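import Mathlib
import HarnessLib
import Literature.Analysis.Fourier.PowerKernelFourierDecay
import Literature.Analysis.SpecialFunctions.BesselKLaplaceMeasure
import Summits.AtomisticToContinuum.Crystallization.Theorems.HolmgrenBoyleLindHalfSpaceUniqueContinuationShellLaplace
import Summits.AtomisticToContinuum.Crystallization.Theorems.HolmgrenBoyleLindHalfSpaceUniqueContinuationLayerSlices

/-!
# Route `HolmgrenBoyleLind`: Lennard-Jones force fields of separated sources, part 15 —
the VERTICAL in-plane Fourier modes as Laplace transforms in the depth

Support file for the crux item stmt-AtomisticToContinuum-6075 (`HalfSpaceUniqueContinuation`, line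
`registered`, layered core; infrastructure written by a stub-worker of lead c3). For the vertical
component `e = u` the slice of part 10 at vertical distance `t > 0` below a source layer is
`v ↦ (−t) ((‖v‖² + t²)^{-4} − (‖v‖² + t²)^{-7})` on the plane `V` (`dim V = 2`). Its in-plane
Fourier transform is, with `ρ = ‖w‖`, `c = 2πρ`, `J_ν(c, t) = ∫ e^{νu − c t cosh u} du`:

* `hbl_fourier_verticalSlice_zero` — at `w = 0`: `−π (t⁻⁵/3 − t⁻¹¹/6)`
  (`Literature.Analysis.Fourier.integral_normSq_add_sq_rpow_neg`: `∫ (‖v‖² + t²)^{-s} = π t^{2−2s}/(s−1)`);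
* `hbl_fourier_powerKernel_eq_besselJ` — for `w ≠ 0`, `s > 1`:
  `𝓕[(‖·‖² + t²)^{-s}](w) = (π/Γ(s)) (πρ/t)^{s−1} J_{s−1}(c, t)` (Schwinger form
  `fourierIntegral_normSq_add_sq_rpow_neg` + cosh substitution
  `Literature.Analysis.SpecialFunctions.integral_rpow_mul_exp_neg_div_sub_mul_sq`);
* `hbl_fourier_verticalSlice` — for `w ≠ 0`:
  `𝓕[slice_t](w) = −(π/6)(πρ)³ t⁻² J₃(c, t) + (π/720)(πρ)⁶ t⁻⁵ J₆(c, t)`;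
* **`hbl_hasSum_verticalMode_eq_laplace`** — summing over a family of sources `q` (phases
  `θ q`, `‖θ q‖ ≤ 1`, heights `y q ≥ 0` with window count, `t_q = X + y_q`, `X > t₀ > 0`):
  `∑_q θ q 𝓕[slice_{t_q}](w) = −(π/6)(πρ)³ I₁ + (π/720)(πρ)⁶ I₂`,
  `Iᵢ = ∫ e^{−l(X − t₀)} σ(max l c) d(besselLaplaceMeasure νᵢ pᵢ c t₀)`, `(ν₁,p₁) = (3,2)`,
  `(ν₂,p₂) = (6,5)`, `σ(l) = ∑_q θ q e^{−l y_q}` (`hbl_hasSum_shell_eq_laplace`, part 12).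
All `[folklore]`; nothing here closes an item.
-/

noncomputable section

namespace Summit.AtomisticToContinuum.Crystallization.Theorems.HolmgrenBoyleLind

open scoped BigOperators Topology RealInnerProductSpace FourierTransform
open MeasureTheory Filter Set Literature.Analysis.SpecialFunctions Literature.Analysis.Fourier

/-! ## Gamma values and the shell series (universe-polymorphic form) -/

/-- `Γ(3) = 2`. [folklore] -/
theorem hbl_Gamma_three : Real.Gamma 3 = 2 := by
  rw [show (3 : ℝ) = ((2 : ℕ) : ℝ) + 1 by norm_num, Real.Gamma_nat_eq_factorial]
  norm_num [Nat.factorial]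

/-- `Γ(4) = 6`. [folklore] -/
theorem hbl_Gamma_four : Real.Gamma 4 = 6 := by
  rw [show (4 : ℝ) = ((3 : ℕ) : ℝ) + 1 by norm_num, Real.Gamma_nat_eq_factorial]
  norm_num [Nat.factorial]

/-- `Γ(6) = 120`. [folklore] -/
theorem hbl_Gamma_six : Real.Gamma 6 = 120 := by
  rw [show (6 : ℝ) = ((5 : ℕ) : ℝ) + 1 by norm_num, Real.Gamma_nat_eq_factorial]
  norm_num [Nat.factorial]

/-- `Γ(7) = 720`. [folklore] -/
theorem hbl_Gamma_seven : Real.Gamma 7 = 720 := by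
  rw [show (7 : ℝ) = ((6 : ℕ) : ℝ) + 1 by norm_num, Real.Gamma_nat_eq_factorial]
  norm_num [Nat.factorial]

/-- **One shell as a Laplace transform in the depth**, universe-polymorphic index type (the landed
`hbl_hasSum_shell_eq_laplace` is registered with `ι : Type`; same four-line proof from the abstract
exchange `hbl_hasSum_integral_shellSeries` and `laplace_besselLaplaceMeasure`): for `X > t₀ > 0`,
`c, p > 0`,
`∑_q θ q (X + y_q)^{-p} J(X + y_q) = ∫ e^{-l(X - t₀)} σ(max l c) d(besselLaplaceMeasure ν p c t₀)`.
[folklore] -/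
theorem hbl_hasSum_shell_eq_laplace_univ {ι : Type*} [Countable ι] {θ : ι → ℂ} {y : ι → ℝ}
    {N : ℕ} (hθ : ∀ q, ‖θ q‖ ≤ 1) (hy : ∀ q, 0 ≤ y q)
    (hN : ∀ j : ℕ, {q : ι | (j : ℝ) ≤ y q ∧ y q ≤ j + 1}.encard ≤ N) (ν : ℝ) {p c t₀ : ℝ}
    (hp : 0 < p) (hc : 0 < c) (ht₀ : 0 < t₀) {X : ℝ} (hX : t₀ < X) :
    HasSum (fun q => θ q * ((((X + y q) ^ (-p) : ℝ) *
        ∫ u : ℝ, Real.exp (ν * u - c * (X + y q) * Real.cosh u) : ℝ) : ℂ))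
      (∫ l, Complex.exp (-((l * (X - t₀) : ℝ) : ℂ)) *
          (∑' q, θ q * Complex.exp (-((y q : ℂ) * ((max l c : ℝ) : ℂ))))
        ∂(besselLaplaceMeasure ν p c t₀)) := by
  -- adapted from `hbl_hasSum_shell_eq_laplace` (…ShellLaplace), verbatim for `ι : Type*`
  haveI := isFiniteMeasure_besselLaplaceMeasure ν hp hc ht₀
  refine (hbl_hasSum_integral_shellSeries hθ hy hN hc hX (besselLaplaceMeasure ν p c t₀)
    (besselLaplaceMeasure_Iio ν hp hc ht₀)).congr_fun fun q => ?_
  rw [laplace_besselLaplaceMeasure ν hp hc ht₀ (by linarith [hy q] : t₀ < X + y q)]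

section Vertical

variable {V : Type*} [NormedAddCommGroup V] [InnerProductSpace ℝ V] [FiniteDimensional ℝ V]
  [MeasurableSpace V] [BorelSpace V]

/-- **The vertical slice transform at frequency `0`** (`dim V = 2`, `t > 0`):
`𝓕[(−t)((‖·‖² + t²)^{-4} − (‖·‖² + t²)^{-7})](0) = −π (t⁻⁵/3 − t⁻¹¹/6)`
(`∫ (‖v‖² + t²)^{-s} = π Γ(s−1)/Γ(s) · t^{2−2s}`, `s = 4, 7`). [folklore] -/
theorem hbl_fourier_verticalSlice_zero (hV : Module.finrank ℝ V = 2) {t : ℝ} (ht : 0 < t) :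
    𝓕 (fun v : V => (((-t) * ((‖v‖ ^ 2 + t ^ 2) ^ (-(4 : ℝ)) - (‖v‖ ^ 2 + t ^ 2) ^ (-(7 : ℝ))) :
      ℝ) : ℂ)) 0 =
      ((-(Real.pi * (t⁻¹ ^ 5 / 3 - t⁻¹ ^ 11 / 6)) : ℝ) : ℂ) := by
  have hd : (Module.finrank ℝ V : ℝ) = 2 := by rw [hV]; norm_num
  have h4 : (Module.finrank ℝ V : ℝ) / 2 < 4 := by rw [hd]; norm_num
  have h7 : (Module.finrank ℝ V : ℝ) / 2 < 7 := by rw [hd]; norm_num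
  rw [Real.fourier_eq]
  simp only [inner_zero_right, neg_zero, AddChar.map_zero_eq_one, one_smul,
    integral_complex_ofReal, Complex.ofReal_inj]
  rw [integral_const_mul, integral_sub (integrable_normSq_add_sq_rpow_neg h4 ht.ne')
    (integrable_normSq_add_sq_rpow_neg h7 ht.ne'), integral_normSq_add_sq_rpow_neg h4 ht,
    integral_normSq_add_sq_rpow_neg h7 ht, hd, show (2 : ℝ) / 2 = 1 by norm_num, Real.rpow_one,
    show (4 : ℝ) - 1 = 3 by norm_num, show (7 : ℝ) - 1 = 6 by norm_num,
    show (2 : ℝ) - 2 * 4 = -((6 : ℕ) : ℝ) by norm_num,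
    show (2 : ℝ) - 2 * 7 = -((12 : ℕ) : ℝ) by norm_num, Real.rpow_neg ht.le, Real.rpow_neg ht.le,
    Real.rpow_natCast, Real.rpow_natCast, hbl_Gamma_three, hbl_Gamma_four, hbl_Gamma_six,
    hbl_Gamma_seven]
  field_simp
  ring

/-- **The power-kernel transform as a Macdonald-type cosh integral** (`dim V = 2`, `s > 1`,
`t > 0`, `w ≠ 0`): `𝓕[(‖·‖² + t²)^{-s}](w) = (π/Γ(s)) (π‖w‖/t)^{s−1} ∫ e^{(s−1)u − 2π‖w‖ t cosh u} du`.
[folklore] -/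
theorem hbl_fourier_powerKernel_eq_besselJ (hV : Module.finrank ℝ V = 2) {s t : ℝ} (hs : 1 < s)
    (ht : 0 < t) {w : V} (hw : w ≠ 0) :
    𝓕 (fun v : V => (((‖v‖ ^ 2 + t ^ 2) ^ (-s) : ℝ) : ℂ)) w =
      ((Real.pi / Real.Gamma s * (Real.pi * ‖w‖ / t) ^ (s - 1) *
        ∫ u : ℝ, Real.exp ((s - 1) * u - 2 * Real.pi * ‖w‖ * t * Real.cosh u) : ℝ) : ℂ) := by
  have hd : (Module.finrank ℝ V : ℝ) = 2 := by rw [hV]; norm_num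
  have hs' : (Module.finrank ℝ V : ℝ) / 2 < s := by rw [hd]; linarith
  have hw' : 0 < ‖w‖ := norm_pos_iff.2 hw
  have hA : 0 < Real.pi ^ 2 * ‖w‖ ^ 2 := by positivity
  have hsq : Real.sqrt (Real.pi ^ 2 * ‖w‖ ^ 2) = Real.pi * ‖w‖ := by
    rw [show Real.pi ^ 2 * ‖w‖ ^ 2 = (Real.pi * ‖w‖) ^ 2 by ring, Real.sqrt_sq (by positivity)]
  -- the cosh substitution in the Schwinger parameter
  have key := integral_rpow_mul_exp_neg_div_sub_mul_sq hA ht (s - 1)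
  rw [hsq, show (2 : ℝ) * (Real.pi * ‖w‖) = 2 * Real.pi * ‖w‖ by ring] at key
  rw [fourierIntegral_normSq_add_sq_rpow_neg hs' ht w, hd, show (2 : ℝ) / 2 = 1 by norm_num,
    Real.rpow_one, key]
  push_cast
  ring

/-- **The vertical slice transform off the zero mode** (`dim V = 2`, `t > 0`, `w ≠ 0`), with
`ρ = ‖w‖`, `c = 2πρ`:
`𝓕[(−t)((‖·‖² + t²)^{-4} − (‖·‖² + t²)^{-7})](w) = −(π/6)(πρ)³ t⁻² J₃(c,t) + (π/720)(πρ)⁶ t⁻⁵ J₆(c,t)`,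
`J_ν(c, t) = ∫ e^{νu − c t cosh u} du`. [folklore] -/
theorem hbl_fourier_verticalSlice (hV : Module.finrank ℝ V = 2) {t : ℝ} (ht : 0 < t) {w : V}
    (hw : w ≠ 0) :
    𝓕 (fun v : V => (((-t) * ((‖v‖ ^ 2 + t ^ 2) ^ (-(4 : ℝ)) - (‖v‖ ^ 2 + t ^ 2) ^ (-(7 : ℝ))) :
      ℝ) : ℂ)) w =
      ((-(Real.pi / 6 * (Real.pi * ‖w‖) ^ 3) *
          ((t ^ (-(2 : ℝ)) : ℝ) * ∫ u : ℝ, Real.exp (3 * u - 2 * Real.pi * ‖w‖ * t * Real.cosh u)) +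
        (Real.pi / 720 * (Real.pi * ‖w‖) ^ 6) *
          ((t ^ (-(5 : ℝ)) : ℝ) * ∫ u : ℝ, Real.exp (6 * u - 2 * Real.pi * ‖w‖ * t * Real.cosh u)) :
        ℝ) : ℂ) := by
  have hd : (Module.finrank ℝ V : ℝ) = 2 := by rw [hV]; norm_num
  have i4 : Integrable fun v : V => (((‖v‖ ^ 2 + t ^ 2) ^ (-(4 : ℝ)) : ℝ) : ℂ) :=
    (integrable_normSq_add_sq_rpow_neg (by rw [hd]; norm_num) ht.ne').ofReal
  have i7 : Integrable fun v : V => (((‖v‖ ^ 2 + t ^ 2) ^ (-(7 : ℝ)) : ℝ) : ℂ) :=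
    (integrable_normSq_add_sq_rpow_neg (by rw [hd]; norm_num) ht.ne').ofReal
  -- the two power kernels in cosh form, `s = 4, 7`
  have h4 := hbl_fourier_powerKernel_eq_besselJ hV (by norm_num : (1 : ℝ) < 4) ht hw
  have h7 := hbl_fourier_powerKernel_eq_besselJ hV (by norm_num : (1 : ℝ) < 7) ht hw
  rw [show (4 : ℝ) - 1 = 3 by norm_num, hbl_Gamma_four] at h4
  rw [show (7 : ℝ) - 1 = 6 by norm_num, hbl_Gamma_seven] at h7
  have hfun : (fun v : V => (((-t) * ((‖v‖ ^ 2 + t ^ 2) ^ (-(4 : ℝ)) -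
      (‖v‖ ^ 2 + t ^ 2) ^ (-(7 : ℝ))) : ℝ) : ℂ)) = fun v : V => ((-t : ℝ) : ℂ) *
        ((((‖v‖ ^ 2 + t ^ 2) ^ (-(4 : ℝ)) : ℝ) : ℂ) - (((‖v‖ ^ 2 + t ^ 2) ^ (-(7 : ℝ)) : ℝ) : ℂ)) := by
    funext v; push_cast; ring
  -- `Pi` subtraction unfolds to the pointwise one definitionally
  have hsub : 𝓕 (fun v : V => (((‖v‖ ^ 2 + t ^ 2) ^ (-(4 : ℝ)) : ℝ) : ℂ) -
      (((‖v‖ ^ 2 + t ^ 2) ^ (-(7 : ℝ)) : ℝ) : ℂ)) w = _ := hbl_fourier_sub_apply i4 i7 w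
  rw [hfun, hbl_fourier_const_mul_apply, hsub, h4, h7, ← Complex.ofReal_sub, ← Complex.ofReal_mul,
    Complex.ofReal_inj]
  simp only [Real.rpow_neg ht.le, Real.rpow_ofNat]
  field_simp
  ring

/-- **The vertical mode of a family of source layers as a signed pair of Laplace transforms.**
Phases `θ q` (`‖θ q‖ ≤ 1`), heights `y q ≥ 0` with window count `N`, frequency `w ≠ 0`
(`c = 2π‖w‖`), `X > t₀ > 0`:
`∑_q θ q 𝓕[slice_{X + y_q}](w) = −(π/6)(π‖w‖)³ I₁ + (π/720)(π‖w‖)⁶ I₂` with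
`Iᵢ = ∫ e^{−l(X − t₀)} (∑_q θ q e^{−y_q max(l,c)}) d(besselLaplaceMeasure νᵢ pᵢ c t₀)(l)`,
`(ν₁, p₁) = (3, 2)`, `(ν₂, p₂) = (6, 5)` (`hbl_hasSum_shell_eq_laplace_univ` and
`hbl_fourier_verticalSlice` termwise); universe-polymorphic form of the registered
`hbl_hasSum_verticalMode_eq_laplace`. [folklore] -/
theorem hbl_hasSum_verticalMode_eq_laplace' (hV : Module.finrank ℝ V = 2) {ι : Type*} [Countable ι]
    {θ : ι → ℂ} {y : ι → ℝ} {N : ℕ} (hθ : ∀ q, ‖θ q‖ ≤ 1) (hy : ∀ q, 0 ≤ y q)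
    (hN : ∀ j : ℕ, {q : ι | (j : ℝ) ≤ y q ∧ y q ≤ j + 1}.encard ≤ N) {w : V} (hw : w ≠ 0)
    {t₀ X : ℝ} (ht₀ : 0 < t₀) (hX : t₀ < X) :
    HasSum (fun q => θ q *
        𝓕 (fun v : V => (((-(X + y q)) *
          ((‖v‖ ^ 2 + (X + y q) ^ 2) ^ (-(4 : ℝ)) - (‖v‖ ^ 2 + (X + y q) ^ 2) ^ (-(7 : ℝ))) : ℝ) : ℂ))
          w)
      (-(((Real.pi / 6 * (Real.pi * ‖w‖) ^ 3 : ℝ)) : ℂ) *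
          (∫ l, Complex.exp (-((l * (X - t₀) : ℝ) : ℂ)) *
              (∑' q, θ q * Complex.exp (-((y q : ℂ) * ((max l (2 * Real.pi * ‖w‖) : ℝ) : ℂ))))
            ∂(besselLaplaceMeasure 3 2 (2 * Real.pi * ‖w‖) t₀)) +
        (((Real.pi / 720 * (Real.pi * ‖w‖) ^ 6 : ℝ)) : ℂ) *
          (∫ l, Complex.exp (-((l * (X - t₀) : ℝ) : ℂ)) *
              (∑' q, θ q * Complex.exp (-((y q : ℂ) * ((max l (2 * Real.pi * ‖w‖) : ℝ) : ℂ))))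
            ∂(besselLaplaceMeasure 6 5 (2 * Real.pi * ‖w‖) t₀))) := by
  have hc : 0 < 2 * Real.pi * ‖w‖ := by have := norm_pos_iff.2 hw; positivity
  -- the two shells `(ν, p) = (3, 2)` and `(6, 5)` as Laplace transforms
  have L1 := hbl_hasSum_shell_eq_laplace_univ hθ hy hN 3 (p := 2) two_pos hc ht₀ hX
  have L2 := hbl_hasSum_shell_eq_laplace_univ hθ hy hN 6 (p := 5) (by norm_num) hc ht₀ hX
  refine ((L1.mul_left (-((Real.pi / 6 * (Real.pi * ‖w‖) ^ 3 : ℝ) : ℂ))).add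
    (L2.mul_left ((Real.pi / 720 * (Real.pi * ‖w‖) ^ 6 : ℝ) : ℂ))).congr_fun fun q => ?_
  have htq : 0 < X + y q := by linarith [hy q]
  rw [hbl_fourier_verticalSlice hV htq hw]
  push_cast
  ring

end Vertical

open FourierTransform renaming fourier → Real.fourierIntegral in
/-- **The vertical mode of a family of source layers as a signed pair of Laplace transforms**,
registered form (`V ι : Type`; the registry spells Mathlib's `𝓕 = FourierTransform.fourier` by its
former name `Real.fourierIntegral`, aliased by the `open … renaming` above so that the registered
header elaborates verbatim): for phases `‖θ q‖ ≤ 1`, heights `y q ≥ 0` with window count `N`,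
`w ≠ 0`, `X > t₀ > 0`,
`∑_q θ q 𝓕[slice_{X + y_q}](w) = −(π/6)(π‖w‖)³ I₁ + (π/720)(π‖w‖)⁶ I₂`,
`Iᵢ = ∫ e^{−l(X − t₀)} (∑_q θ q e^{−y_q max(l, 2π‖w‖)}) d(besselLaplaceMeasure νᵢ pᵢ (2π‖w‖) t₀)(l)`,
`(ν₁, p₁) = (3, 2)`, `(ν₂, p₂) = (6, 5)` (`hbl_hasSum_verticalMode_eq_laplace'`). [folklore] -/
theorem hbl_hasSum_verticalMode_eq_laplace : ∀ {V : Type} [NormedAddCommGroup V] [InnerProductSpace ℝ V] [FiniteDimensional ℝ V] [MeasurableSpace V] [BorelSpace V], Module.finrank ℝ V = 2 → ∀ {ι : Type} [Countable ι] {θ : ι → ℂ} {y : ι → ℝ} {N : ℕ}, (∀ q, ‖θ q‖ ≤ 1) → (∀ q, 0 ≤ y q) → (∀ j : ℕ, {q : ι | (j : ℝ) ≤ y q ∧ y q ≤ j + 1}.encard ≤ N) → ∀ {w : V}, w ≠ 0 → ∀ {t₀ X : ℝ}, 0 < t₀ → t₀ < X → HasSum (fun q => θ q * Real.fourierIntegral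 (fun v : V => (((-(X + y q)) * ((‖v‖ ^ 2 + (X + y q) ^ 2) ^ (-(4 : ℝ)) - (‖v‖ ^ 2 + (X + y q) ^ 2) ^ (-(7 : ℝ))) : ℝ) : ℂ)) w) (-(((Real.pi / 6 * (Real.pi * ‖w‖) ^ 3 : ℝ)) : ℂ) * (∫ l, Complex.exp (-((l * (X - t₀) : ℝ) : ℂ)) * (∑' q, θ q * Complex.exp (-((y q : ℂ) * ((max l (2 * Real.pi * ‖w‖) : ℝ) : ℂ)))) ∂(Literature.Analysis.SpecialFunctions.besselLaplaceMeasure 3 2 (2 * Real.pi * ‖w‖) t₀)) + (((Real.pi / 720 * (Real.pi * ‖w‖) ^ 6 : ℝ)) : ℂ) * (∫ l, Complex.exp (-((l * (X - t₀) : ℝ) : ℂ)) * (∑' q, θ q * Complex.exp (-((y q : ℂ) * ((max l (2 * Real.pi * ‖w‖) : ℝ) : ℂ)))) ∂(Literature.Analysis.SpecialFunctions.besselLaplaceMeasure 6 5 (2 * Real.pi * ‖w‖) t₀))) := by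
  intro V _ _ _ _ _ hV ι _ θ y N hθ hy hN w hw t₀ X ht₀ hX
  exact hbl_hasSum_verticalMode_eq_laplace' hV hθ hy hN hw ht₀ hX

end Summit.AtomisticToContinuum.Crystallization.Theorems.HolmgrenBoyleLind

end
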